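import Summits.CriticalPhenomena.PercolationContinuityZ3.Theorems.PercNearOneGluingNoHeavyQuantOneArmTwoEventually
import Literature.Barriers.CriticalPhenomena.LaceExpansionEtaZeroXSpaceExplicit
import HarnessLib

/-!
# (T1) with the SHARP exponent `2` for EVERY `d ≥ 10⁵⁰` — unconditional, explicit threshold

PAPER-2 track (i), ARM-3 (the power-law landmark), gen 6; companion of `…QuantOneArmTwoEventually.lean`
(`Quant.oneArmPolyDecayAtCritical_two_eventually`: `∃ D > 6, ∀ d ≥ D, …`, threshold existential).
builds on p205010 (kernel theorem, internal audit signed; external expert review pending).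

The barrier catalogue now carries Hara's `x`-space asymptotics and Kozma–Nachmias's `ρ_ex = 1/2` with the
EXPLICIT threshold of the formal Hara–Slade proof
(`Literature.Barriers.CriticalPhenomena.rhoExHalf_of_haraSladeThreshold_le`, `…_of_ten_pow_fifty_le`,
`LaceExpansionEtaZeroXSpaceExplicit.lean`: `D_HS = 4 160 000·(275·5000·300·(16⁴+1)·4¹³)² ≈ 1.37·10⁴⁹ ≤ 10⁵⁰`).
In the lane's vocabulary this upgrades the tree's explicit unconditional row
`Quant.oneArmPolyDecay_of_ten_pow_fifty_le` (exponent `1/2`, `…QuantOneArmOfChiSubcritical.lean`) to the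
sharp exponent:

* `Quant.oneArmPolyDecayAtCritical_two_of_haraSladeThreshold_le`, **`Quant.oneArmPolyDecayAtCritical_two_of_ten_pow_fifty_le`**
  — `10⁵⁰ ≤ d → ∃ C, OneArmPolyDecayAtCritical d 2 C` (`π_{p_c(ℤ^d)}(n) ≤ C n^{−2}`), UNCONDITIONAL;
* `Quant.oneArm_two_sided_of_ten_pow_fifty_le` — `c n^{−2} ≤ π_{p_c}(n) ≤ C n^{−2}` for every `d ≥ 10⁵⁰`;
* `Quant.oneArmPolyDecayAtCritical_exponent_le_two_of_ten_pow_fifty_le` — for `d ≥ 10⁵⁰` every (T1) instance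
  has exponent `c ≤ 2` (attained and extremal);
* `Quant.meanFieldArmRows_of_ten_pow_fifty_le` — for every `d ≥ 10⁵⁰`: `(∃ C > 0, ThetaHolderNearCritical d 1 C) ∧
  (∃ C, OneArmPolyDecayAtCritical d 2 C) ∧ (∀ c C, OneArmPolyDecayAtCritical d c C → c ≤ 2)`.

So the dimension axis of the lane's (T1) table reads, in the kernel: `d = 2` power law (exponent `2^{−158}`);
`3 ≤ d ≤ 6` OPEN (the landmark; `c ≤ d/3`); `7 ≤ d ≤ 10` open (no method in print); `11 ≤ d < 10⁵⁰` exponent `2`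
modulo the named facts `Hara2008_etaZeroXSpace` / Fitzner–van der Hofstad's computer-assisted bounds;
**`d ≥ 10⁵⁰`: exponent `2`, both bounds, UNCONDITIONAL**.  Honest reading: reproduction of published theorems
(Hara–Slade 1990, Hara 2008, Kozma–Nachmias 2011) with the un-optimised threshold of the formal proof; nothing
here bears on `3 ≤ d ≤ 6`.
-/

noncomputable section

namespace Summit.CriticalPhenomena.PercolationContinuityZ3.Theorems.Quant

open Literature.Probability.LatticeModels Literature.Probability.Percolation
  Literature.Barriers.CriticalPhenomena

variable {d : ℕ}

/-- **(T1) with the sharp exponent `2` for every `d ≥ D_HS = 4 160 000·(275·5000·300·(16⁴+1)·4¹³)²`, UNCONDITIONAL**: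
`∃ C, OneArmPolyDecayAtCritical d 2 C` (Kozma–Nachmias 2011 Thm. 1 on the tree's explicit Hara–Slade / Hara chain).
[cite: KozmaNachmias2011, Thm. 1] [cite: Hara2008, Thm. 1.1] [cite: HaraSlade1990, Thm. 1.1 and p. 339] -/
theorem oneArmPolyDecayAtCritical_two_of_haraSladeThreshold_le
    (hd : 4160000 * (275 * 5000 * (300 * (16 ^ 4 + 1)) * 4 ^ 13) ^ 2 ≤ d) :
    ∃ C : ℝ, OneArmPolyDecayAtCritical d 2 C :=
  oneArmPolyDecayAtCritical_two_of_twoPointBoundedRatio (lt_of_lt_of_le (by norm_num) hd)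
    (twoPointBoundedRatio_of_haraSladeThreshold_le hd)

/-- **For every `d ≥ 10⁵⁰`: `∃ C, OneArmPolyDecayAtCritical d 2 C`**, i.e. `π_{p_c(ℤ^d)}(n) ≤ C n^{−2}` for all
`n ≥ 1` — the sharp mean-field one-arm law as an UNCONDITIONAL kernel theorem with an explicit dimension threshold
(standard axioms, no named fact).  Upgrades `Quant.oneArmPolyDecay_of_ten_pow_fifty_le` (exponent `1/2`).
[cite: KozmaNachmias2011, Thm. 1] [cite: Hara2008, Thm. 1.1] -/
theorem oneArmPolyDecayAtCritical_two_of_ten_pow_fifty_le (hd : 10 ^ 50 ≤ d) :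
    ∃ C : ℝ, OneArmPolyDecayAtCritical d 2 C :=
  oneArmPolyDecayAtCritical_two_of_haraSladeThreshold_le (le_trans (by norm_num) hd)

/-- **Both mean-field one-arm bounds for every `d ≥ 10⁵⁰`, UNCONDITIONAL**: `∃ c > 0, ∃ C`, for all `n ≥ 1`,
`c n^{−2} ≤ P_{p_c}(0 ↔ ∂B(n)) ≤ C n^{−2}` (the tree's `rhoExHalf_of_ten_pow_fifty_le` in the lane's vocabulary).
[cite: KozmaNachmias2011, Thm. 1] [cite: HeydenreichVanDerHofstad2017, Thm. 11.5 (11.3.2)] -/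
theorem oneArm_two_sided_of_ten_pow_fifty_le (hd : 10 ^ 50 ≤ d) :
    ∃ c C : ℝ, 0 < c ∧ ∀ n : ℕ, 1 ≤ n →
      c * (n : ℝ) ^ (-(2 : ℝ)) ≤ (bondPercolation (zdGraph d) (criticalProbI d)).real (siteToBoundary d n) ∧
        (bondPercolation (zdGraph d) (criticalProbI d)).real (siteToBoundary d n) ≤ C * (n : ℝ) ^ (-(2 : ℝ)) := by
  obtain ⟨c, C, hc, hcC⟩ := rhoExHalf_of_ten_pow_fifty_le hd
  refine ⟨c, C, hc, fun n hn => ?_⟩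
  have hn0 : (0 : ℝ) < n := by exact_mod_cast hn
  have hrw : (n : ℝ) ^ (-(2 : ℝ)) = ((n : ℝ) ^ 2)⁻¹ := by rw [Real.rpow_neg hn0.le, Real.rpow_two]
  obtain ⟨hlo, hhi⟩ := hcC n hn
  constructor
  · calc c * (n : ℝ) ^ (-(2 : ℝ)) = c / (n : ℝ) ^ 2 := by rw [hrw, div_eq_mul_inv]
      _ ≤ oneArmProb d (criticalProbI d) n := hlo
      _ = (bondPercolation (zdGraph d) (criticalProbI d)).real (siteToBoundary d n) := rfl
  · calc (bondPercolation (zdGraph d) (criticalProbI d)).real (siteToBoundary d n)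
        = oneArmProb d (criticalProbI d) n := rfl
      _ ≤ C / (n : ℝ) ^ 2 := hhi
      _ = C * (n : ℝ) ^ (-(2 : ℝ)) := by rw [hrw, div_eq_mul_inv]

/-- **For every `d ≥ 10⁵⁰` the one-arm exponent `2` is extremal**: any `OneArmPolyDecayAtCritical d c C` has `c ≤ 2`
(`oneArmPolyDecayAtCritical_exponent_le_two_of_rhoExHalf` with `rhoExHalf_of_ten_pow_fifty_le`).  Unconditional.
[cite: KozmaNachmias2011, Thm. 1 (lower bound)] -/
theorem oneArmPolyDecayAtCritical_exponent_le_two_of_ten_pow_fifty_le (hd : 10 ^ 50 ≤ d) {c C : ℝ}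
    (h : OneArmPolyDecayAtCritical d c C) : c ≤ 2 :=
  oneArmPolyDecayAtCritical_exponent_le_two_of_rhoExHalf (rhoExHalf_of_ten_pow_fifty_le hd) h

/-- **The complete mean-field row of the (T1)/(T2) table for EVERY `d ≥ 10⁵⁰`, UNCONDITIONAL**:
(i) `∃ C > 0, ThetaHolderNearCritical d 1 C` (the kernel Hara–Slade triangle condition with its explicit threshold,
`triangleCondition_of_haraSladeThreshold_le`, and Barsky–Aizenman `β = 1`), (ii) `∃ C, OneArmPolyDecayAtCritical d 2 C`
(Kozma–Nachmias), (iii) every (T1) instance has exponent `≤ 2`.  Standard axioms, no named fact.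
[cite: HaraSlade1990, Thm. 1.1] [cite: HeydenreichVanDerHofstad2017, Thm. 4.1, Thm. 5.1 and Thm. 11.5] [cite: KozmaNachmias2011, Thm. 1] -/
theorem meanFieldArmRows_of_ten_pow_fifty_le (hd : 10 ^ 50 ≤ d) :
    (∃ C : ℝ, 0 < C ∧ ThetaHolderNearCritical d 1 C) ∧
      (∃ C : ℝ, OneArmPolyDecayAtCritical d 2 C) ∧
      (∀ c C : ℝ, OneArmPolyDecayAtCritical d c C → c ≤ 2) :=
  ⟨thetaHolderNearCritical_one_of_triangle (le_trans (by norm_num) hd)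
      (triangleCondition_of_haraSladeThreshold_le (le_trans (by norm_num) hd)),
    oneArmPolyDecayAtCritical_two_of_ten_pow_fifty_le hd,
    fun _ _ h => oneArmPolyDecayAtCritical_exponent_le_two_of_ten_pow_fifty_le hd h⟩

end Summit.CriticalPhenomena.PercolationContinuityZ3.Theorems.Quant

end
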